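import Summits.BirchSwinnertonDyer.BirchSwinnertonDyer.Theorems.ManinLocalTwoThreeTVRigidityLemmaA
import HarnessLib

/-!
# E-an-142 in the tree, part 2: the deep rows `(A B; N qᵉ k, D)` — [R-I], [R-II], [R-III], the MULTI-HUB EQUATION (5.3),
# the two-sided relation and LINEARITY (5.5) — PROOFS-an-72 §5.2–5.5

Summit `BirchSwinnertonDyer`, route `ManinLocalTwoThree` (cell bsd-f2-manin), cruxes C2/C3 (stmt-BirchSwinnertonDyer-22967/22968) through
E-an-142 `TowerExtension.TVPatternRigidity` / the obligation node `TowerExtension.MultiHubImpliesRigidity`.  Prover seat bsd-line-manin23-p1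
(C2/C3 LEAD), gen 10.  Port BY VALUE (unbundled binders, no definitions) of the corresponding block of the an planner's L9 skeleton
`HOME/an/g30/TowerRigiditySkeleton-an-g30.lean` (60268fc1e4a910cb), continuing `…TVRigidityLemmaA.lean`.

* `fine_RI` — deep row, instance `i = e`, `j − e ≥ s ≥ 1`: `c γ = g j ρ − g e (D ρ)`;
* `fine_RII` — instance `i − e ≥ s ≥ 1`, `j = e`: `c γ = g e (A ρ) − g i ρ`;
* `fine_RIII` — instance `i = j = e`, `D ≡ ε (mod Nk)`: `c γ = g e y − g e x`, `Nk·x = ε − D`, `Nk·y = A − ε`;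
* **`fine_multiHub`** — (5.3) THE MULTI-HUB EQUATION, integer form: `D ≡ 1 (mod Nk)` ⟹ `g e ρ − g e (D ρ) = g e y − g e x` with `Nk·x = 1 − D`,
  `Nk·y = A − 1` (this is the hypothesis p2's class-independence file (5.4) consumes);
* `fine_twoSided` — with class-independence: `γ_i + γ_j = 2γ_e` when `i, j ≥ e + s`, `q^{i+j−2e} ≡ ±1 (mod N)`;
* **`linearity`** — (5.5): `γ_{e+2} − γ_{e+1} = γ_{e+1} − γ_e`;  `linear_of_second_diff` — hence `γ_n = n·γ_1`.

HONEST FRAMING: bookkeeping toward `MultiHubImpliesRigidity` (class-independence (5.4) is p2's, the assembly is part 3); nothing here is a law;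
E-an-142, E-an-135, C2, C3, Manin's conjecture and BSD are NOT proved by this file.  Credits: the an planner's skeleton, re-keyed to tree binders.
-/

set_option autoImplicit false
set_option linter.dupNamespace false

namespace Summit.BirchSwinnertonDyer.BirchSwinnertonDyer.Theorems.ManinLocalTwoThree.TVRigidity

open Matrix
open scoped MatrixGroups

variable {N q p s : ℕ} {g : ℕ → ℤ → ZMod p} {c : SL(2, ℤ) → ZMod p}

section Rows

variable (level0 : ∀ r : ℤ, g 0 r = 0)
  (period : ∀ (n : ℕ) (r : ℤ), g n (r + (q : ℤ) ^ n) = g n r)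
  (even : ∀ (n : ℕ) (r : ℤ), g n (-r) = g n r)
  (inv : ∀ γ : SL(2, ℤ), (N : ℤ) ∣ (γ : Matrix (Fin 2) (Fin 2) ℤ) 1 0 →
    ∀ (r : ℤ) (i j : ℕ) (ε : ℤˣ),
      (γ : Matrix (Fin 2) (Fin 2) ℤ) 1 0 * r + (γ : Matrix (Fin 2) (Fin 2) ℤ) 1 1 * (q : ℤ) ^ i = (ε : ℤ) * (q : ℤ) ^ j →
      g j ((ε : ℤ) * ((γ : Matrix (Fin 2) (Fin 2) ℤ) 0 0 * r + (γ : Matrix (Fin 2) (Fin 2) ℤ) 0 1 * (q : ℤ) ^ i)) - g i r = c γ)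
  (hres : ∀ (n : ℕ) (r t : ℤ), s ≤ n → IsCoprime r (q : ℤ) → g n (r + t * (q : ℤ) ^ s) = g n r)

include period even inv hres in
/-- **[R-I]** (PROOFS-an-72 §5.2), deep row `(A B; N qᵉ k, D)`, instance `i = e`, `j − e ≥ s ≥ 1`: `c γ = g j ρ − g e (D ρ)`. -/
theorem fine_RI (hs : 1 ≤ s) (γ : SL(2, ℤ)) (k e j L : ℕ) (he : 1 ≤ e) (hj : e + s ≤ j) (hL : s ≤ L)
    (ρ : ℤ) (hρ : ((N * k : ℕ) : ℤ) * ρ ≡ 1 [ZMOD (q : ℤ) ^ L])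
    (hC : (γ : Matrix (Fin 2) (Fin 2) ℤ) 1 0 = ((N * q ^ e * k : ℕ) : ℤ)) (ε : ℤˣ)
    (hD : (γ : Matrix (Fin 2) (Fin 2) ℤ) 1 1 ≡ (ε : ℤ) * (q : ℤ) ^ (j - e) [ZMOD ((N * k : ℕ) : ℤ)]) :
    c γ = g j ρ - g e ((γ : Matrix (Fin 2) (Fin 2) ℤ) 1 1 * ρ) := by
  obtain ⟨hDq, -⟩ := isCoprime_diag γ he hC
  have hρq : IsCoprime ρ (q : ℤ) := isCoprime_rho (by omega) hρ
  have hdet := SL_det_entries γ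
  obtain ⟨x, hx⟩ := hD.dvd
  obtain ⟨w, hw⟩ := hρ.dvd
  push_cast at hC hx hw
  have hje : (q : ℤ) ^ j = (q : ℤ) ^ e * (q : ℤ) ^ (j - e) := by rw [← pow_add]; congr 1; omega
  have hjes : (q : ℤ) ^ (j - e) = (q : ℤ) ^ s * (q : ℤ) ^ (j - e - s) := by rw [← pow_add]; congr 1; omega
  have hLs : (q : ℤ) ^ L = (q : ℤ) ^ s * (q : ℤ) ^ (L - s) := by rw [← pow_add]; congr 1; omega
  have hN : (N : ℤ) ∣ (γ : Matrix (Fin 2) (Fin 2) ℤ) 1 0 := by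
    rw [hC]; exact Dvd.intro ((q : ℤ) ^ e * (k : ℤ)) (by ring)
  have h1 := inv γ hN x e j ε (by rw [hC]; linear_combination - ((q : ℤ) ^ e) * hx - (ε : ℤ) * hje)
  have e1 : x = -((γ : Matrix (Fin 2) (Fin 2) ℤ) 1 1 * ρ)
      + ((ε : ℤ) * ρ * (q : ℤ) ^ (j - e - s) + x * w * (q : ℤ) ^ (L - s)) * (q : ℤ) ^ s := by
    linear_combination (-ρ) * hx + x * hw + ((ε : ℤ) * ρ) * hjes + (x * w) * hLs
  have g1 : g e x = g e ((γ : Matrix (Fin 2) (Fin 2) ℤ) 1 1 * ρ) := by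
    rw [of_shift_res period hres e _ (hDq.mul_left hρq).neg_left e1, even]
  set X := (γ : Matrix (Fin 2) (Fin 2) ℤ) 0 0 * x + (γ : Matrix (Fin 2) (Fin 2) ℤ) 0 1 * (q : ℤ) ^ e with hXdef
  have hX : (N : ℤ) * (k : ℤ) * X = (γ : Matrix (Fin 2) (Fin 2) ℤ) 0 0 * (ε : ℤ) * (q : ℤ) ^ (j - e) - 1 := by
    rw [hXdef]
    linear_combination (-(γ : Matrix (Fin 2) (Fin 2) ℤ) 0 0) * hx - hdet - ((γ : Matrix (Fin 2) (Fin 2) ℤ) 0 1) * hC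
  have e2 : X = -ρ + ((γ : Matrix (Fin 2) (Fin 2) ℤ) 0 0 * (ε : ℤ) * ρ * (q : ℤ) ^ (j - e - s) + X * w * (q : ℤ) ^ (L - s)) *
      (q : ℤ) ^ s := by
    linear_combination ρ * hX + X * hw + ((γ : Matrix (Fin 2) (Fin 2) ℤ) 0 0 * (ε : ℤ) * ρ) * hjes + (X * w) * hLs
  have g2 : g j ((ε : ℤ) * X) = g j ρ := by
    rw [units_arg even, of_shift_res period hres j _ hρq.neg_left e2, even]
  rw [← h1, g2, g1]

include period even inv hres in
/-- **[R-II]** (5.2), deep row, instance `i − e ≥ s ≥ 1`, `j = e`: `c γ = g e (A ρ) − g i ρ` (`A = γ₀₀ ≡ D⁻¹`). -/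
theorem fine_RII (hs : 1 ≤ s) (γ : SL(2, ℤ)) (k e i L : ℕ) (he : 1 ≤ e) (hi : e + s ≤ i) (hL : s ≤ L)
    (ρ : ℤ) (hρ : ((N * k : ℕ) : ℤ) * ρ ≡ 1 [ZMOD (q : ℤ) ^ L])
    (hC : (γ : Matrix (Fin 2) (Fin 2) ℤ) 1 0 = ((N * q ^ e * k : ℕ) : ℤ)) (ε : ℤˣ)
    (hD : (γ : Matrix (Fin 2) (Fin 2) ℤ) 1 1 * (q : ℤ) ^ (i - e) ≡ (ε : ℤ) [ZMOD ((N * k : ℕ) : ℤ)]) :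
    c γ = g e ((γ : Matrix (Fin 2) (Fin 2) ℤ) 0 0 * ρ) - g i ρ := by
  obtain ⟨-, h00q⟩ := isCoprime_diag γ he hC
  have hρq : IsCoprime ρ (q : ℤ) := isCoprime_rho (by omega) hρ
  have hdet := SL_det_entries γ
  obtain ⟨r, hr⟩ := hD.dvd
  obtain ⟨w, hw⟩ := hρ.dvd
  push_cast at hC hr hw
  have hie : (q : ℤ) ^ i = (q : ℤ) ^ e * (q : ℤ) ^ (i - e) := by rw [← pow_add]; congr 1; omega
  have hies : (q : ℤ) ^ (i - e) = (q : ℤ) ^ s * (q : ℤ) ^ (i - e - s) := by rw [← pow_add]; congr 1; omega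
  have hLs : (q : ℤ) ^ L = (q : ℤ) ^ s * (q : ℤ) ^ (L - s) := by rw [← pow_add]; congr 1; omega
  have hN : (N : ℤ) ∣ (γ : Matrix (Fin 2) (Fin 2) ℤ) 1 0 := by
    rw [hC]; exact Dvd.intro ((q : ℤ) ^ e * (k : ℤ)) (by ring)
  have h1 := inv γ hN r i e ε
    (by rw [hC]; linear_combination - ((q : ℤ) ^ e) * hr + ((γ : Matrix (Fin 2) (Fin 2) ℤ) 1 1) * hie)
  have e1 : r = (ε : ℤ) * ρ
      + (-((γ : Matrix (Fin 2) (Fin 2) ℤ) 1 1 * ρ * (q : ℤ) ^ (i - e - s)) + r * w * (q : ℤ) ^ (L - s)) * (q : ℤ) ^ s := by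
    linear_combination (-ρ) * hr + r * hw - ((γ : Matrix (Fin 2) (Fin 2) ℤ) 1 1 * ρ) * hies + (r * w) * hLs
  have hε : IsCoprime (ε : ℤ) (q : ℤ) := by
    rcases Int.units_eq_one_or ε with h | h
    · rw [h]; exact isCoprime_one_left
    · rw [h]; exact isCoprime_one_left.neg_left
  have g1 : g i r = g i ρ := by
    rw [of_shift_res period hres i _ (hε.mul_left hρq) e1, units_arg even]
  set X := (γ : Matrix (Fin 2) (Fin 2) ℤ) 0 0 * r + (γ : Matrix (Fin 2) (Fin 2) ℤ) 0 1 * (q : ℤ) ^ i with hXdef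
  have hX : (N : ℤ) * (k : ℤ) * X = (γ : Matrix (Fin 2) (Fin 2) ℤ) 0 0 * (ε : ℤ) - (q : ℤ) ^ (i - e) := by
    rw [hXdef]
    linear_combination (-(γ : Matrix (Fin 2) (Fin 2) ℤ) 0 0) * hr - ((q : ℤ) ^ (i - e)) * hdet
      - ((γ : Matrix (Fin 2) (Fin 2) ℤ) 0 1 * (q : ℤ) ^ (i - e)) * hC + ((γ : Matrix (Fin 2) (Fin 2) ℤ) 0 1 * (N : ℤ) * (k : ℤ)) * hie
  have e2 : X = (γ : Matrix (Fin 2) (Fin 2) ℤ) 0 0 * (ε : ℤ) * ρ + (-(ρ * (q : ℤ) ^ (i - e - s)) + X * w * (q : ℤ) ^ (L - s)) *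
      (q : ℤ) ^ s := by
    linear_combination ρ * hX + X * hw - ρ * hies + (X * w) * hLs
  have g2 : g e ((ε : ℤ) * X) = g e ((γ : Matrix (Fin 2) (Fin 2) ℤ) 0 0 * ρ) := by
    rw [units_arg even, of_shift_res period hres e _ ((h00q.mul_left hε).mul_left hρq) e2]
    have : (γ : Matrix (Fin 2) (Fin 2) ℤ) 0 0 * (ε : ℤ) * ρ = (ε : ℤ) * ((γ : Matrix (Fin 2) (Fin 2) ℤ) 0 0 * ρ) := by ring
    rw [this, units_arg even]
  rw [← h1, g2, g1]

include inv in
/-- **[R-III]** (5.2), deep row, instance `i = j = e` with `D ≡ ε (mod Nk)`: `c γ = g e y − g e x`, `Nk·x = ε − D`, `Nk·y = A − ε`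
(exact integers, no resolution needed; `N, k ≥ 1`). -/
theorem fine_RIII (hN0 : 0 < N) (γ : SL(2, ℤ)) (k e : ℕ) (hk : 0 < k)
    (hC : (γ : Matrix (Fin 2) (Fin 2) ℤ) 1 0 = ((N * q ^ e * k : ℕ) : ℤ)) (ε : ℤˣ) (x y : ℤ)
    (hx : ((N * k : ℕ) : ℤ) * x = (ε : ℤ) - (γ : Matrix (Fin 2) (Fin 2) ℤ) 1 1)
    (hy : ((N * k : ℕ) : ℤ) * y = (γ : Matrix (Fin 2) (Fin 2) ℤ) 0 0 - (ε : ℤ)) :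
    c γ = g e y - g e x := by
  have hdet := SL_det_entries γ
  have hε2 := units_sq_int ε
  push_cast at hC hx hy
  have hN : (N : ℤ) ∣ (γ : Matrix (Fin 2) (Fin 2) ℤ) 1 0 := by
    rw [hC]; exact Dvd.intro ((q : ℤ) ^ e * (k : ℤ)) (by ring)
  have h1 := inv γ hN x e e ε (by rw [hC]; linear_combination ((q : ℤ) ^ e) * hx)
  have hNk : ((N : ℤ) * (k : ℤ)) ≠ 0 := by
    have : (0 : ℤ) < (N : ℤ) * (k : ℤ) := by positivity
    exact this.ne'
  have h2 : (N : ℤ) * (k : ℤ) * ((ε : ℤ) * ((γ : Matrix (Fin 2) (Fin 2) ℤ) 0 0 * x + (γ : Matrix (Fin 2) (Fin 2) ℤ) 0 1 * (q : ℤ) ^ e))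
      = (N : ℤ) * (k : ℤ) * y := by
    linear_combination ((ε : ℤ) * (γ : Matrix (Fin 2) (Fin 2) ℤ) 0 0) * hx - hy
      + ((γ : Matrix (Fin 2) (Fin 2) ℤ) 0 0) * hε2 - (ε : ℤ) * hdet - ((ε : ℤ) * (γ : Matrix (Fin 2) (Fin 2) ℤ) 0 1) * hC
  rw [mul_left_cancel₀ hNk h2] at h1
  rw [← h1]

include level0 period even inv hres in
/-- **(5.3) THE MULTI-HUB EQUATION** (PROOFS-an-72 §5.3; from [R-I], [R-III], LEMMA A), integer form: for the deep row `(A B; N qᵉ k, D)`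
with `D ≡ 1 (mod Nk)`: `g e ρ − g e (D ρ) = g e y − g e x` with `Nk·x = 1 − D`, `Nk·y = A − 1` (`ρ` an inverse of `Nk` to precision
`q^L`, `L ≥ e + φ(Nk)·s`, `s ≥ 1`). -/
theorem fine_multiHub (hq : q.Prime) (hqpN : ¬ q ∣ p * N) (hN0 : 0 < N) (hs : 1 ≤ s)
    (γ : SL(2, ℤ)) (k e L : ℕ) (hk : 0 < k) (hkq : Nat.Coprime k q) (he : 1 ≤ e) (hL : e + Nat.totient (N * k) * s ≤ L)
    (ρ : ℤ) (hρ : ((N * k : ℕ) : ℤ) * ρ ≡ 1 [ZMOD (q : ℤ) ^ L])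
    (hC : (γ : Matrix (Fin 2) (Fin 2) ℤ) 1 0 = ((N * q ^ e * k : ℕ) : ℤ))
    (hD : (γ : Matrix (Fin 2) (Fin 2) ℤ) 1 1 ≡ 1 [ZMOD ((N * k : ℕ) : ℤ)]) (x y : ℤ)
    (hx : ((N * k : ℕ) : ℤ) * x = 1 - (γ : Matrix (Fin 2) (Fin 2) ℤ) 1 1)
    (hy : ((N * k : ℕ) : ℤ) * y = (γ : Matrix (Fin 2) (Fin 2) ℤ) 0 0 - 1) :
    g e ρ - g e ((γ : Matrix (Fin 2) (Fin 2) ℤ) 1 1 * ρ) = g e y - g e x := by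
  have hφ : 0 < Nat.totient (N * k) := Nat.totient_pos.mpr (Nat.mul_pos hN0 hk)
  have hst : s ≤ Nat.totient (N * k) * s := Nat.le_mul_of_pos_left s hφ
  have hsL : s ≤ L := le_trans hst (le_trans (Nat.le_add_left _ _) hL)
  have hq1 : (q : ℤ) ^ (Nat.totient (N * k) * s) ≡ 1 [ZMOD ((N * k : ℕ) : ℤ)] := pow_totient_mul hq hqpN k hkq s
  have h3 := fine_RIII inv hN0 γ k e hk hC 1 x y (by simpa using hx) (by simpa using hy)
  have hje : e + Nat.totient (N * k) * s - e = Nat.totient (N * k) * s := Nat.add_sub_cancel_left ..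
  have hD' : (γ : Matrix (Fin 2) (Fin 2) ℤ) 1 1 ≡ ((1 : ℤˣ) : ℤ) * (q : ℤ) ^ (e + Nat.totient (N * k) * s - e)
      [ZMOD ((N * k : ℕ) : ℤ)] := by
    rw [Units.val_one, one_mul, hje]; exact hD.trans hq1.symm
  have h1 := fine_RI period even inv hres hs γ k e (e + Nat.totient (N * k) * s) L he (Nat.add_le_add_left hst e) hsL ρ hρ
    hC 1 hD'
  have hA := lemmaA_eq level0 period even inv hq hqpN k L hkq ρ hρ (e + Nat.totient (N * k) * s) e hL
    (le_trans (Nat.le_add_right e _) hL) 1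
    (by rw [Units.val_one, one_mul, pow_add]; simpa using (Int.ModEq.refl ((q : ℤ) ^ e)).mul hq1)
  rw [← hA, ← h1, h3]

include period even inv hres in
/-- **(5.5), two-sided relation** (from [R-I], [R-II] on the row `(A B; N qᵉ, q^{j−e} + N)`) with class-independence `hci`:
`γ_i + γ_j = 2γ_e` whenever `i, j ≥ e + s` and `q^{i+j−2e} ≡ ±1 (mod N)`. -/
theorem fine_twoSided (hq0 : q.Prime) (hqpN : ¬ q ∣ p * N) (hs : 1 ≤ s)
    (hci : ∀ (e : ℕ) (r r' : ℤ), IsCoprime r (q : ℤ) → IsCoprime r' (q : ℤ) → g e r = g e r')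
    (e i j : ℕ) (he : 1 ≤ e) (hi : e + s ≤ i) (hj : e + s ≤ j) (ε : ℤˣ)
    (hq : (q : ℤ) ^ (i + j - 2 * e) ≡ (ε : ℤ) [ZMOD (N : ℤ)]) :
    g i 1 + g j 1 = 2 * g e 1 := by
  have hqN : IsCoprime (q : ℤ) (N : ℤ) := by simpa using isCoprime_q_Nk hq0 hqpN 1 (Nat.coprime_one_left q)
  obtain ⟨ρ, v, hρv⟩ := (hqN.pow_left (m := s)).symm
  have hρ1 : ((N * 1 : ℕ) : ℤ) * ρ ≡ 1 [ZMOD (q : ℤ) ^ s] :=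
    Int.modEq_iff_dvd.mpr ⟨v, by push_cast; linear_combination -hρv⟩
  have hρq : IsCoprime ρ (q : ℤ) := isCoprime_rho hs hρ1
  have hjq : (q : ℤ) ^ (j - e) = (q : ℤ) ^ (j - e - 1) * (q : ℤ) := by rw [← pow_succ]; congr 1; omega
  obtain ⟨a1, b1, hab⟩ := hqN.symm
  have hDq : IsCoprime ((q : ℤ) ^ (j - e) + (N : ℤ)) (q : ℤ) :=
    ⟨a1, b1 - a1 * (q : ℤ) ^ (j - e - 1), by linear_combination hab + a1 * hjq⟩
  have hDN : IsCoprime ((q : ℤ) ^ (j - e) + (N : ℤ)) (N : ℤ) := by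
    simpa using (hqN.pow_left (m := j - e)).add_mul_right_left 1
  have hDC : IsCoprime ((q : ℤ) ^ (j - e) + (N : ℤ)) ((N * q ^ e * 1 : ℕ) : ℤ) := by
    push_cast; rw [mul_one]; exact hDN.mul_right hDq.pow_right
  obtain ⟨A, B', hAB⟩ := hDC
  obtain ⟨γ, h00, -, hC, h11⟩ := exists_SL2_of_det A (-B') ((N * q ^ e * 1 : ℕ) : ℤ) ((q : ℤ) ^ (j - e) + (N : ℤ))
    (by linear_combination hAB)
  have hD1 : (γ : Matrix (Fin 2) (Fin 2) ℤ) 1 1 ≡ ((1 : ℤˣ) : ℤ) * (q : ℤ) ^ (j - e) [ZMOD ((N * 1 : ℕ) : ℤ)] := by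
    rw [h11, Units.val_one, one_mul, Nat.mul_one]
    exact Int.modEq_iff_dvd.mpr ⟨-1, by ring⟩
  have h1 := fine_RI period even inv hres hs γ 1 e j s he hj le_rfl ρ hρ1 hC 1 hD1
  have hije : (q : ℤ) ^ (j - e) * (q : ℤ) ^ (i - e) = (q : ℤ) ^ (i + j - 2 * e) := by rw [← pow_add]; congr 1; omega
  have hD2 : (γ : Matrix (Fin 2) (Fin 2) ℤ) 1 1 * (q : ℤ) ^ (i - e) ≡ (ε : ℤ) [ZMOD ((N * 1 : ℕ) : ℤ)] := by
    rw [h11, Nat.mul_one]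
    have : ((q : ℤ) ^ (j - e) + (N : ℤ)) * (q : ℤ) ^ (i - e) ≡ (q : ℤ) ^ (i + j - 2 * e) [ZMOD (N : ℤ)] :=
      Int.modEq_iff_dvd.mpr ⟨-(q : ℤ) ^ (i - e), by rw [← hije]; ring⟩
    exact this.trans hq
  have h2 := fine_RII period even inv hres hs γ 1 e i s he hi le_rfl ρ hρ1 hC ε hD2
  obtain ⟨hDq', h00q⟩ := isCoprime_diag γ he hC
  have one_q : IsCoprime (1 : ℤ) (q : ℤ) := isCoprime_one_left
  rw [hci j ρ 1 hρq one_q, hci e _ 1 (hDq'.mul_left hρq) one_q] at h1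
  rw [hci e _ 1 (h00q.mul_left hρq) one_q, hci i ρ 1 hρq one_q] at h2
  rw [h1] at h2
  linear_combination h2

include level0 period even inv hres in
/-- **(5.5) LINEARITY** (PROOFS-an-72 §5.5; from LEMMA A + `fine_twoSided`): with every level constant on units (`γ_e := g e 1`),
`γ_{e+2} − γ_{e+1} = γ_{e+1} − γ_e` for every `e`. -/
theorem linearity (hq0 : q.Prime) (hqpN : ¬ q ∣ p * N) (hN0 : 0 < N) (hs : 1 ≤ s)
    (hci : ∀ (e : ℕ) (r r' : ℤ), IsCoprime r (q : ℤ) → IsCoprime r' (q : ℤ) → g e r = g e r') :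
    ∀ e : ℕ, g (e + 2) 1 - g (e + 1) 1 = g (e + 1) 1 - g e 1 := by
  intro e
  have hφ : 0 < Nat.totient N := Nat.totient_pos.mpr hN0
  obtain ⟨t, ht, htdef⟩ : ∃ t, s + 1 ≤ t ∧ t = Nat.totient N * (s + 1) :=
    ⟨Nat.totient N * (s + 1), Nat.le_mul_of_pos_left (s + 1) hφ, rfl⟩
  have hqt : (q : ℤ) ^ t ≡ 1 [ZMOD (N : ℤ)] := by rw [htdef]; exact pow_totient_N hq0 hqpN (s + 1)
  have hexp : (e + 2 + t) + (e + t) - 2 * (e + 1) = 2 * t := by omega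
  have hq2 : (q : ℤ) ^ ((e + 2 + t) + (e + t) - 2 * (e + 1)) ≡ ((1 : ℤˣ) : ℤ) [ZMOD (N : ℤ)] := by
    rw [hexp, Units.val_one, mul_comm, pow_mul]; simpa using hqt.pow 2
  have two := fine_twoSided period even inv hres hq0 hqpN hs hci (e + 1) (e + 2 + t) (e + t) (by omega) (by omega)
    (by omega) 1 hq2
  have hqN : IsCoprime (q : ℤ) (N : ℤ) := by simpa using isCoprime_q_Nk hq0 hqpN 1 (Nat.coprime_one_left q)
  obtain ⟨ρ, v, hρv⟩ := (hqN.pow_left (m := e + 2 + t)).symm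
  have hρ1 : ((N * 1 : ℕ) : ℤ) * ρ ≡ 1 [ZMOD (q : ℤ) ^ (e + 2 + t)] :=
    Int.modEq_iff_dvd.mpr ⟨v, by push_cast; linear_combination -hρv⟩
  have hρq : IsCoprime ρ (q : ℤ) := isCoprime_rho (by omega) hρ1
  have hAi := lemmaA_eq level0 period even inv hq0 hqpN 1 (e + 2 + t) (Nat.coprime_one_left q) ρ hρ1 (e + 2 + t) (e + 2)
    le_rfl (by omega) 1
    (by rw [Nat.mul_one, Units.val_one, one_mul, pow_add]; simpa using (Int.ModEq.refl ((q : ℤ) ^ (e + 2))).mul hqt)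
  have hAj := lemmaA_eq level0 period even inv hq0 hqpN 1 (e + 2 + t) (Nat.coprime_one_left q) ρ hρ1 (e + t) e
    (by omega) (by omega) 1
    (by rw [Nat.mul_one, Units.val_one, one_mul, pow_add]; simpa using (Int.ModEq.refl ((q : ℤ) ^ e)).mul hqt)
  have one_q : IsCoprime (1 : ℤ) (q : ℤ) := isCoprime_one_left
  rw [hci (e + 2 + t) 1 ρ one_q hρq, hci (e + t) 1 ρ one_q hρq, hAi, hAj, hci (e + 2) ρ 1 hρq one_q,
    hci e ρ 1 hρq one_q] at two
  linear_combination two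

end Rows

/-- **From vanishing second differences to linearity** (elementary): `γ₀ = 0` and `γ_{e+2} − γ_{e+1} = γ_{e+1} − γ_e` give `γ_n = n·γ_1`. -/
theorem linear_of_second_diff (γ : ℕ → ZMod p) (h0 : γ 0 = 0)
    (h : ∀ e : ℕ, γ (e + 2) - γ (e + 1) = γ (e + 1) - γ e) :
    ∀ n : ℕ, γ n = γ 1 * (n : ZMod p) := by
  have hd : ∀ n : ℕ, γ (n + 1) - γ n = γ 1 := by
    intro n
    induction n with
    | zero => simp [h0]
    | succ n ih =>
        have := h n
        rw [show n + 1 + 1 = n + 2 from rfl]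
        rw [this, ih]
  intro n
  induction n with
  | zero => simp [h0]
  | succ n ih =>
      have e1 : γ (n + 1) = γ n + γ 1 := by
        have := hd n; rw [sub_eq_iff_eq_add] at this; rw [this]; ring
      rw [e1, ih]; push_cast; ring

end Summit.BirchSwinnertonDyer.BirchSwinnertonDyer.Theorems.ManinLocalTwoThree.TVRigidity
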